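import Literature.Computability.Cryptography.ChenQuantumLWEDisplayRefutation

/-!
# Chen's Lemma 3.8 "with certainty" fails for every processing of coordinate 0

REPRODUCTION / ANALYSIS OF A CLAIMED RESULT UNDER ADJUDICATION (withdrawn): Yilei Chen, *Quantum
Algorithms for Lattice Problems*, IACR ePrint 2024/555, version of 2024-04-18 [ChenQuantumLattice2024],
Lemma 3.8 (p. 26) / eq. (41) (p. 37–38): the measured `u` satisfies
`u₁ + ⟨b*[2..n+1], u[2..n+1]⟩ ≡ 0 (mod p₁p′)` ALWAYS.  Bundle `papers/QuantumAdvantage/lwe-quantum-autopsy/`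
(Part 1, STEPS.md §4.4).  HONEST FRAMING: a kernel-checked THEOREM about a WITHDRAWN algorithm — a precise
negative result, NOT summit progress, no cryptanalytic claim in either direction.

`ChenQuantumLWESteps.lean` types the certainty claim as `Shape.Lemma38Certainty ψ9` for whatever state `ψ9`
Step 9 feeds to the final `QFT`.  Steps (9.e)–(9.g) act on coordinate `0` of `|φ8.f⟩` only (domain
extension, division, phase kick; the withdrawn (9.e) cannot be performed at all, `Shape.not_step9Display`).
Here `Shape.processed K` is `|φ8.f⟩` after an ARBITRARY kernel `K` (any matrix: unitary, measurement
branch, or not even physical) on coordinate `0`, and the theorem is: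

* `Shape.lemma38Certainty_forces_null` — for every admissible shape whose `b*[1..n] mod Q` generate `ℤ_Q`
  (Bezout witness; true for Chen's `b*` by eq. (39), `b*_η ≡ b₁ = -1 (mod p_η)`), and every kernel `K`:
  if `Lemma38Certainty (processed K)` holds then `QFT (processed K) = 0` identically.  I.e. the certainty
  claim is compatible only with a state the `QFT` annihilates (for a unitary `K`, never).
  (For a unitary `K` this never happens — `K ⊗ 1` preserves the norm and `QFT` is injective — but that
  remark is not formalised here; instead:)
* `Shape.not_lemma38Certainty_phi8f` — the unconditional instance `K = 1`: `QFT|φ8.f⟩(0) = G ≠ 0`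
  (`‖G‖² = P`, `ChenQuantumLWEDisplayRefutation`), so `Lemma38Certainty |φ8.f⟩` is false outright.
The proof uses the output law `Shape.outputWeight_eq` (the weight of `(u₀,u′)` is `w(u₀)·Q`, independent of
`u′`): if `w(u₀) ≠ 0` every `u′` occurs, but `u′ = 0` and `u′ = w` (the Bezout witness) demand residues of
`u₀` modulo `Q` differing by `Σ_t w_t b*_t ≡ 1`.
-/

namespace Literature.Computability.Cryptography.Chen2024

open scoped BigOperators

/-- For `Q ∣ N`, the residue mod `Q` of the representative of `k mod N` is `k mod Q`. [folklore] -/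
theorem natCast_val_intCast_of_dvd {N Q : ℕ} [NeZero N] (hQN : Q ∣ N) (k : ℤ) :
    ((((k : ZMod N)).val : ℕ) : ZMod Q) = (k : ZMod Q) := by
  rw [← map_intCast (ZMod.castHom hQN (ZMod Q)) k, ZMod.castHom_apply, ZMod.cast_eq_val]

namespace Shape

variable (S : Shape)

/-- `|φ8.f⟩` after an arbitrary kernel `K` on coordinate `0` (`K x y`: new value `x`, old value `y`):
`(processed K)(z) = Σ_y K (z 0) y · φ8f(y, z[1..n])`. [cite: ChenQuantumLattice2024, §3.5.9 (9.e)–(9.g) pp. 37–38] -/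
noncomputable def processed (K : ZMod S.N → ZMod S.N → ℂ) : Ket (S.n + 1) S.N :=
  fun z => ∑ y : ZMod S.N, K (z 0) y * S.phi8f (Fin.cons y (Fin.tail z))

/-- The output law transported to the full `QFT` of `processed K`: the weight of `(u₀, u′)` is `w(u₀)·Q`,
independent of `u′`. [cite: ChenQuantumLattice2024, Lemma 2.12 p. 12 and §3.5.9 (9.h) p. 38] -/
theorem qft_processed_weight (h : S.Admissible) (K : ZMod S.N → ZMod S.N → ℂ) :
    ∃ w : ZMod S.N → ℝ, ∀ (u₀ : ZMod S.N) (u' : Fin S.n → ZMod S.N),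
      ‖qft (S.processed K) (Fin.cons u₀ u')‖ ^ 2 = w u₀ * S.Q := by
  obtain ⟨w, hw⟩ := S.outputWeight_eq h
    (fun (u₀ : ZMod S.N) (y : ZMod S.N) =>
      ∑ x : ZMod S.N, e (-(((x.val * u₀.val : ℕ) : ℚ) / S.N)) * K x y)
  refine ⟨w, fun u₀ u' => ?_⟩
  rw [← hw u₀ u']
  have h1 : qft (S.processed K) (Fin.cons u₀ u')
      = qftTail (fun z : ZMod S.N × (Fin S.n → ZMod S.N) =>
          ∑ x : ZMod S.N, e (-(((x.val * z.1.val : ℕ) : ℚ) / S.N)) * splitFirst (S.processed K) (x, z.2))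
          (u₀, u') :=
    splitFirst_qft (S.processed K) u₀ u'
  have h2 : (fun z : ZMod S.N × (Fin S.n → ZMod S.N) =>
          ∑ x : ZMod S.N, e (-(((x.val * z.1.val : ℕ) : ℚ) / S.N)) * splitFirst (S.processed K) (x, z.2))
      = fun z : ZMod S.N × (Fin S.n → ZMod S.N) =>
          ∑ y : ZMod S.N, (∑ x : ZMod S.N, e (-(((x.val * z.1.val : ℕ) : ℚ) / S.N)) * K x y)
            * splitFirst S.phi8f (y, z.2) := by
    funext z
    simp only [splitFirst, Shape.processed, Fin.cons_zero, Fin.tail_cons, Finset.mul_sum,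
      Finset.sum_mul]
    rw [Finset.sum_comm]
    refine Finset.sum_congr rfl fun y _ => Finset.sum_congr rfl fun x _ => ?_
    ring
  rw [h1, h2]

/-- **Lemma 3.8's certainty claim forces a `QFT`-null state.**  For every admissible shape with a Bezout
witness for `b*[1..n] mod Q` and every kernel `K` on coordinate `0`: `Lemma38Certainty (processed K)`
implies `QFT (processed K) = 0`.  (Chen's Step 9 claims eq. (41) with certainty for the processed state;
by the output law, for each `u₀` either no `u′` occurs or all do, and `u′ = 0`, `u′ = w` would need
residues of `u₀` modulo `Q` differing by `Σ_t w_t b*_t ≡ 1 (mod Q)`.)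
[cite: ChenQuantumLattice2024, Lemma 3.8 p. 26; eq. (41) p. 37] -/
theorem lemma38Certainty_forces_null (h : S.Admissible) (K : ZMod S.N → ZMod S.N → ℂ)
    (w : Fin S.n → ℤ) (hw : ((∑ t, w t * S.bstar (Fin.succ t) : ℤ) : ZMod S.Q) = 1)
    (hL : S.Lemma38Certainty (S.processed K)) : qft (S.processed K) = 0 := by
  haveI : Fact (1 < (S.Q : ℕ)) := ⟨by have := h.three_le_Q; omega⟩
  obtain ⟨wt, hwt⟩ := S.qft_processed_weight h K
  have hQN : (S.Q : ℕ) ∣ S.N :=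
    ⟨(S.D : ℕ) * S.D * S.p₁, by simp only [Shape.N, Shape.P, PNat.mul_coe]; ring⟩
  have hQP : ((S.Q : ℕ) : ℤ) ∣ ((S.P : ℕ) : ℤ) :=
    ⟨S.p₁, by simp only [Shape.P, PNat.mul_coe]; push_cast; ring⟩
  -- Step 1: every coordinate-0 value `u₀` has weight function `wt u₀ = 0`.
  have key : ∀ u₀ : ZMod S.N, wt u₀ = 0 := by
    intro u₀
    by_contra hne
    have hnz : ∀ v : Fin S.n → ZMod S.N, qft (S.processed K) (Fin.cons u₀ v) ≠ 0 := by
      intro v h0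
      have h1 := hwt u₀ v
      rw [h0, norm_zero, zero_pow two_ne_zero] at h1
      have hQ : ((S.Q : ℕ) : ℝ) ≠ 0 := Nat.cast_ne_zero.2 (PNat.ne_zero S.Q)
      exact hne ((mul_eq_zero.1 h1.symm).resolve_right hQ)
    -- eq. (41) at `u′ = 0` and at `u′ = w`
    have e0 := hL _ (hnz 0)
    have e1 := hL _ (hnz fun t => (w t : ZMod S.N))
    simp only [Shape.eq41, Fin.cons_zero, Fin.cons_succ, Pi.zero_apply, ZMod.val_zero,
      Nat.cast_zero, mul_zero, Finset.sum_const_zero, add_zero] at e0 e1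
    rw [ZMod.intCast_zmod_eq_zero_iff_dvd] at e0 e1
    have hd : ((S.Q : ℕ) : ℤ) ∣ ∑ t : Fin S.n, S.bstar (Fin.succ t) * (((w t : ZMod S.N).val : ℕ) : ℤ) := by
      have := dvd_sub e1 e0
      rw [add_sub_cancel_left] at this
      exact dvd_trans hQP this
    rw [← ZMod.intCast_zmod_eq_zero_iff_dvd] at hd
    push_cast at hd
    simp only [natCast_val_intCast_of_dvd hQN] at hd
    have hw' : ∑ t : Fin S.n, (S.bstar (Fin.succ t) : ZMod S.Q) * (w t : ZMod S.Q) = 1 := by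
      push_cast at hw
      rw [← hw]
      exact Finset.sum_congr rfl fun t _ => mul_comm _ _
    rw [hw'] at hd
    exact one_ne_zero hd
  -- Step 2: hence every amplitude vanishes.
  funext u
  have h1 := hwt (u 0) (Fin.tail u)
  rw [key, zero_mul, Fin.cons_self_tail] at h1
  have h2 : ‖qft (S.processed K) u‖ = 0 := by
    have := (pow_eq_zero_iff two_ne_zero).1 h1
    exact this
  rw [Pi.zero_apply]
  exact norm_eq_zero.1 h2

/-- The identity kernel leaves `|φ8.f⟩` unchanged. [folklore] -/
theorem processed_one : S.processed (fun x y => if x = y then 1 else 0) = S.phi8f := by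
  funext z
  simp only [Shape.processed, ite_mul, one_mul, zero_mul]
  rw [Fintype.sum_ite_eq (z 0) fun y => S.phi8f (Fin.cons y (Fin.tail z))]
  exact congrArg S.phi8f (Fin.cons_self_tail z)

/-- `QFT ψ (0) = Σ_z ψ z` (the kernel is `1` at `u = 0`). [cite: ChenQuantumLattice2024, Lemma 2.12 p. 12] -/
theorem qft_at_zero (ψ : Ket (S.n + 1) S.N) : qft ψ 0 = ∑ z, ψ z := by
  unfold qft
  refine Finset.sum_congr rfl fun z _ => ?_
  simp only [Pi.zero_apply, ZMod.val_zero, mul_zero, Finset.sum_const_zero, Nat.cast_zero, neg_zero,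
    zero_div, e, Rat.cast_zero, mul_zero, Complex.exp_zero, mul_one]

/-- **Unconditional instance.**  Already for `|φ8.f⟩` itself (no processing, `K = 1`) the certainty claim
is false: `QFT|φ8.f⟩(0) = G = Σ_{j<P} e(-j²/P) ≠ 0` (`‖G‖² = P`), while `lemma38Certainty_forces_null`
would force it to vanish. [cite: ChenQuantumLattice2024, Lemma 3.8 p. 26; eq. (40)–(41) pp. 36–37] -/
theorem not_lemma38Certainty_phi8f (h : S.Admissible) (w : Fin S.n → ℤ)
    (hw : ((∑ t, w t * S.bstar (Fin.succ t) : ℤ) : ZMod S.Q) = 1) : ¬ S.Lemma38Certainty S.phi8f := by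
  intro hL
  have h0 := S.lemma38Certainty_forces_null h (fun x y => if x = y then 1 else 0) w hw
    (by rw [processed_one]; exact hL)
  rw [processed_one] at h0
  have h1 := congrFun h0 0
  rw [qft_at_zero, Pi.zero_apply, S.sum_phi8f] at h1
  have hn := S.norm_sq_chirpSum h
  rw [h1, norm_zero, zero_pow two_ne_zero] at hn
  exact (NeZero.ne (S.P : ℕ)) (by exact_mod_cast hn.symm)

end Shape

end Literature.Computability.Cryptography.Chen2024
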